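import Literature.MathematicalPhysics.QuantumFieldTheory.Balaban1983to89.Node00.TorusCoverCubeDomains
import Literature.MathematicalPhysics.QuantumFieldTheory.Balaban1983to89.Node00.DomainsMeet
import Literature.MathematicalPhysics.QuantumFieldTheory.Balaban1983to89.T4AxialGaugeSmallField
import HarnessLib

/-!
# N07 [B11] (= [15] = [Balaban1985Variational]) Sect. F (144) AT THE RECORD: **EVERY CUBE `□_{j′}^{(j′)}` OF THE DATUM's LOCAL FAMILY, WITH ITS ONE-BLOCK COLLAR, LIES UNDER
# PRINT's TOP WINDOW `□̃ = [a − 2ρ, a + M − 1 + 2ρ]`** — the geometric half of [15] (144) «`□₀ ⊃ □₁ ⊃ … ⊃ □_k ⊃ □`, `dist(□_{n+1}, □_nᶜ) = R₁M₁Lⁿη`» and [6] p. 98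
# «a cube which we denote by `□̃` … a distance of its boundary to `□₀` is equal to `2R₁M₁`», read for the TORUS family `cubeDomains` of print's (150) and for the chart's windows

Cell `pub-ymgap`, seat `pub-ymgap-dag-n07-e` g24 (FAN-OUT §N07 row s3; LANE OWNER of the K0 road), MODULE 73, INTENT-73 (cell bus 2026-08-28T23:40Z).  `--kind proof --supports
stmt-QuantumFields-20541 --as helper` (K0⁷; count-neutral).  [15] = [Balaban1985Variational]; [6] = [Balaban1985RegularSpaces].

WHY (⚑ LOCATED-S3-CHART-INTERFACE (F1), cell bus I.44008; `HOME/pub-ymgap-dag-n07-e/LOCATED-S3-CHART-INTERFACE.md`).  The datum `(j, idx)` of the grid-cube family `(Mc, ρ)` carries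
print's local family `D″ = cubeDomains ⊓ record` ((150)), whose cube at level `j′ ≤ j` is `□_{j′}^{(j′)} = [sqLo … j j′, sqHi … j j′]` with margin `ρ·gs L (j − j′) = ρ·Σ_{i ≤ j−j′} Lⁱ`
(`B8Eq131Cubes`), and the chart's HCHART-MEET-NORM windows are these cubes with a one-block collar `[sqLo − 1, sqHi + 1]` (MODULE 59).  A top axial window of margin `ρ + 1`
(MODULE 60's `NrmOfRecord`) does NOT cover them (`ρ·gs L n > (ρ+1)Lⁿ` as soon as `ρ > L`); PRINT's window `□̃` of margin `2ρ` DOES, collar included, because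
`ρ·gs L n + 1 ≤ 2ρ·Lⁿ` (`B8Eq131Cubes.margin_collar`, `2 ≤ L`, `1 ≤ ρ`).  This file states that containment in the three currencies a consumer needs: labels (`InBox`), torus
sites (`cubeOm` ∕ `cubeDomains` ∕ the meet's `LamSite`, as membership in the blow-down window `castSite ″ [tlo n, thi n]`), and the recursion showing that the windows
`[tlo L (tLo a ρ) n, thi L (tHi a M ρ) n]` ARE the blow-down windows `lo j′ = L·lo (j′+1)`, `hi j′ = L·hi (j′+1) + (L − 1)` of dag-n07-w6's ladders (`…N07DataDownTheTowerBlowDown`).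

WHAT IS PROVED (integer ∕ cover bookkeeping; NOTHING of [15]∕[6] analysis).
* §1 labels: `sqLo_sub_one_apply` · `sqHi_add_one_apply` · ★ `inBox_tcubeWindow_of_inBox_cubeCollar` (the collared cube's labels lie in `[tlo L (tLo a ρ) (k − j′), thi L (tHi a M ρ) (k − j′)]`)
  · `inBox_tcubeWindow_of_inBox_cube` (without the collar).
* §2 torus: ★★ `cubeDomains_Om_subset_castSite_image_tcubeWindow` (`1 ≤ j′ ≤ k`: every site of `Ω′_{j′} = π_{j′} ″ □_{j′}^{(j′)}` lies in the blow-down window) ·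
  `lamSite_domainsMeet_cubeDomains_mem_tcubeWindow` (hence every cell site of the meet family at a positive level) · `coverAt_cubeCollar_mem_tcubeWindow` (the chart's collared labels).
* §3 the windows as blow-downs: `tlo_tLo_succ_apply` · `thi_tHi_succ_apply` (`tlo (n+1) = L·tlo n`, `thi (n+1) = L·thi n + (L − 1)`), `tlo_tLo_zero` · `thi_tHi_zero` (the top window is □̃ itself).

HONEST FRAMING.  Count-neutral helper; by-name bookkeeping over lit-balaban (`B8Eq131Cubes`, `B8Ineq130`, `Node00.TorusCoverCubeDomains`, `Node00.DomainsMeet`) and pv26 (`castSite`);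
nothing of Bałaban's analysis asserted; no hypothesis of the knit discharged; `stub_prop8StepCoP13` ∕ K0⁷ ∕ K1⁹ NOT closed; N07 NOT discharged; counts unmoved (typed 28∕28 ·
discharged 6∕28); one finite 𝕋⁴ programme at fixed ε — the route closes the conditional finite-𝕋⁴ rung `BalabanLadder.UV` only; the YM mass gap (Clay) is NOT proved by any of this;
nothing continuum ∕ ℝ⁴ ∕ OS.  No `sorry`, no `def`, no `instance`, no `notation`.

References: [15] (144) p. 300, (147) p. 301, (150) p. 301; [6] p. 98, (1.131) p. 99.
-/

set_option autoImplicit false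

namespace Summit.QuantumFields.YangMills.BalabanUVNodes.N07CubeTowerUnderPrintWindow

open Literature.MathematicalPhysics.QuantumFieldTheory.Balaban1983to89
open Literature.MathematicalPhysics.QuantumFieldTheory.Balaban1983to89.Node00
open B14DomainGeom (Pt)
open B7Prop1Local (InBox)
open B8Ineq130 (tlo thi tlo_apply thi_apply)
open B8Eq131Cubes (sqLo sqHi tLo tHi bLo bHi gs margin_collar)
open B6SectADomainsV1 (Domains)
open T4AxialGaugeSmallField (castSite)

/-! ## §1  Labels: the collared cube `[sqLo − 1, sqHi + 1]` at level `j′` lies in the window `[tlo (k − j′), thi (k − j′)]` of `□̃` -/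

section Labels

variable {d : ℕ}

/-- Coordinates of the collared lower corner: `(sqLo L a ρ k j′ − 1) i = L^{k−j′}·a i − (ρ·gs L (k−j′) + 1)`. [cite: Balaban1985RegularSpaces, (1.131) p.99 (bookkeeping)] -/
theorem sqLo_sub_one_apply (L : ℕ) (a : Fin d → ℤ) (ρ k j' : ℕ) (i : Fin d) :
    (sqLo L a ρ k j' - 1) i = (L : ℤ) ^ (k - j') * a i - ((ρ * gs L (k - j') : ℕ) : ℤ) - 1 := by
  simp [sqLo, bLo]

/-- Coordinates of the collared upper corner: `(sqHi L a M ρ k j′ + 1) i = L^{k−j′}·(a i + M) − 1 + ρ·gs L (k−j′) + 1`. [cite: Balaban1985RegularSpaces, (1.131) p.99 (bookkeeping)] -/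
theorem sqHi_add_one_apply (L : ℕ) (a : Fin d → ℤ) (M ρ k j' : ℕ) (i : Fin d) :
    (sqHi L a M ρ k j' + 1) i = (L : ℤ) ^ (k - j') * (a i + M) - 1 + ((ρ * gs L (k - j') : ℕ) : ℤ) + 1 := by
  simp [sqHi, bHi]

/-- ★ **THE COLLARED CUBE LIES UNDER `□̃`** (labels): for `2 ≤ L`, `1 ≤ ρ` (any `j′`; for `j′ > k` the depth `k − j′` is `0`), every label of `[sqLo L a ρ k j′ − 1, sqHi L a M ρ k j′ + 1]` lies in the level-`j′` window
`[tlo L (tLo a ρ) (k − j′), thi L (tHi a M ρ) (k − j′)]` of print's `□̃ = [a − 2ρ, a + M − 1 + 2ρ]` — the integer fact `ρ·gs L n + 1 ≤ 2ρ·Lⁿ` (`margin_collar`).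
[cite: Balaban1985Variational, (144) p.300; Balaban1985RegularSpaces, p.98, (1.131) p.99] -/
theorem inBox_tcubeWindow_of_inBox_cubeCollar {L : ℕ} (hL : 2 ≤ L) {ρ : ℕ} (hρ : 1 ≤ ρ) (a : Fin d → ℤ) (M k j' : ℕ)
    {s : Fin d → ℤ} (hs : InBox (sqLo L a ρ k j' - 1) (sqHi L a M ρ k j' + 1) s) :
    InBox (tlo L (tLo a ρ) (k - j')) (thi L (tHi a M ρ) (k - j')) s := by
  have hm : ρ * gs L (k - j') + 1 ≤ L ^ (k - j') * (2 * ρ) := by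
    have := margin_collar (k := k - j') (j := 0) hL hρ (Nat.zero_le _)
    simpa using this
  have hmz : ((ρ * gs L (k - j') : ℕ) : ℤ) + 1 ≤ (L : ℤ) ^ (k - j') * (2 * ρ) := by exact_mod_cast hm
  intro i
  obtain ⟨h1, h2⟩ := hs i
  rw [sqLo_sub_one_apply] at h1
  rw [sqHi_add_one_apply] at h2
  rw [tlo_apply, thi_apply]
  simp only [tLo, tHi]
  constructor <;> nlinarith

/-- The uncollared cube lies under `□̃` too. [cite: Balaban1985Variational, (144) p.300; Balaban1985RegularSpaces, p.98] -/
theorem inBox_tcubeWindow_of_inBox_cube {L : ℕ} (hL : 2 ≤ L) {ρ : ℕ} (hρ : 1 ≤ ρ) (a : Fin d → ℤ) (M k j' : ℕ)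
    {s : Fin d → ℤ} (hs : InBox (sqLo L a ρ k j') (sqHi L a M ρ k j') s) :
    InBox (tlo L (tLo a ρ) (k - j')) (thi L (tHi a M ρ) (k - j')) s := by
  refine inBox_tcubeWindow_of_inBox_cubeCollar hL hρ a M k j' fun i => ?_
  obtain ⟨h1, h2⟩ := hs i
  refine ⟨?_, ?_⟩
  · rw [Pi.sub_apply, Pi.one_apply]; omega
  · rw [Pi.add_apply, Pi.one_apply]; omega

end Labels

/-! ## §2  Torus: the family's positive-level regions and the chart's collared labels lie in the blow-down windows of `□̃` -/

section Torus

variable {P : Params} {a : Pt P.d} {M ρ k : ℕ} {hk : k ≤ P.m + P.K}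

/-- ★★ **`Ω′_{j′} = π_{j′} ″ □_{j′}^{(j′)}` LIES IN THE BLOW-DOWN WINDOW OF `□̃`**: for `1 ≤ ρ` and `1 ≤ j′ ≤ k`, every site of `(cubeDomains P a M ρ k hk).Om j′` lies in
`castSite ″ [tlo L (tLo a ρ) (k − j′), thi L (tHi a M ρ) (k − j′)]` (`2 ≤ L` is the standing `Params.hL`). [cite: Balaban1985Variational, (144) p.300, (150) p.301; Balaban1985RegularSpaces, (1.131) p.99] -/
theorem cubeDomains_Om_subset_castSite_image_tcubeWindow (hρ : 1 ≤ ρ) {j' : ℕ} (hj : 1 ≤ j') (hjk : j' ≤ k) {y : Site P j'}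
    (hy : y ∈ (cubeDomains P a M ρ k hk).Om j') :
    y ∈ (castSite '' Set.Icc (tlo P.L (tLo a ρ) (k - j')) (thi P.L (tHi a M ρ) (k - j')) : Set (Site P j')) := by
  obtain ⟨s, hs, rfl⟩ := (mem_cubeDomains_Om_iff hj hjk y).1 hy
  have hs' := inBox_tcubeWindow_of_inBox_cube P.hL.2 hρ a M k j' hs
  exact ⟨s, ⟨fun i => (hs' i).1, fun i => (hs' i).2⟩, rfl⟩

/-- ★ **EVERY POSITIVE-LEVEL CELL SITE OF THE MEET FAMILY `D″ = cubeDomains ⊓ D₂` LIES IN THE BLOW-DOWN WINDOW OF `□̃`** (`LamSite ⇒ ∈ Om ⇒ ∈` the cube's region).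
[cite: Balaban1985Variational, (150) p.301; Balaban1984PropagatorsII, (2.3) p.224] -/
theorem lamSite_domainsMeet_cubeDomains_mem_tcubeWindow (hρ : 1 ≤ ρ) (D₂ : Domains P) {j' : ℕ} (hj : 1 ≤ j') (hjk : j' ≤ k) {y : Site P j'}
    (hy : (domainsMeet (cubeDomains P a M ρ k hk) D₂).LamSite j' y) :
    y ∈ (castSite '' Set.Icc (tlo P.L (tLo a ρ) (k - j')) (thi P.L (tHi a M ρ) (k - j')) : Set (Site P j')) := by
  have h1 : y ∈ (domainsMeet (cubeDomains P a M ρ k hk) D₂).Om j' := hy.1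
  have h2 : y ∈ (cubeDomains P a M ρ k hk).Om j' := (Finset.mem_inter.1 h1).1
  exact cubeDomains_Om_subset_castSite_image_tcubeWindow hρ hj hjk h2

/-- ★ **THE CHART's COLLARED WINDOWS LIE UNDER `□̃`** (torus labels): a label of `[sqLo … j′ − 1, sqHi … j′ + 1]` casts into the blow-down window of `□̃` at level `j′`.
[cite: Balaban1985Variational, (144) p.300; Balaban1985RegularSpaces, p.98] -/
theorem coverAt_cubeCollar_mem_tcubeWindow (hρ : 1 ≤ ρ) (j' : ℕ) {s : Pt P.d}
    (hs : InBox (sqLo P.L a ρ k j' - 1) (sqHi P.L a M ρ k j' + 1) s) :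
    (castSite s : Site P j') ∈ (castSite '' Set.Icc (tlo P.L (tLo a ρ) (k - j')) (thi P.L (tHi a M ρ) (k - j')) : Set (Site P j')) := by
  have hs' := inBox_tcubeWindow_of_inBox_cubeCollar P.hL.2 hρ a M k j' hs
  exact ⟨s, ⟨fun i => (hs' i).1, fun i => (hs' i).2⟩, rfl⟩

end Torus

/-! ## §3  The windows of `□̃` ARE blow-down windows (`lo n+1 = L·lo n`, `hi n+1 = L·hi n + (L − 1)`), the top one being `□̃` itself -/

section Windows

variable {d : ℕ}

/-- `tlo L (tLo a ρ) 0 = tLo a ρ = a − 2ρ`. [cite: Balaban1985RegularSpaces, p.98 (bookkeeping)] -/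
theorem tlo_tLo_zero (L : ℕ) (a : Fin d → ℤ) (ρ : ℕ) : tlo L (tLo a ρ) 0 = fun i => a i - 2 * ρ := by
  funext i; simp [tLo]

/-- `thi L (tHi a M ρ) 0 = tHi a M ρ = a + M − 1 + 2ρ`. [cite: Balaban1985RegularSpaces, p.98 (bookkeeping)] -/
theorem thi_tHi_zero (L : ℕ) (a : Fin d → ℤ) (M ρ : ℕ) : thi L (tHi a M ρ) 0 = fun i => a i + M - 1 + 2 * ρ := by
  funext i; simp [tHi]

/-- The lower corners recurse as blow-downs: `tlo (n+1) i = L · tlo n i`. [cite: Balaban1987RG1, (0.1) p.251 (bookkeeping)] -/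
theorem tlo_tLo_succ_apply (L : ℕ) (lo : Fin d → ℤ) (n : ℕ) (i : Fin d) : tlo L lo (n + 1) i = (L : ℤ) * tlo L lo n i :=
  B8Ineq130.tlo_succ_apply L lo n i

/-- The upper corners recurse as blow-downs: `thi (n+1) i = L · thi n i + (L − 1)`. [cite: Balaban1987RG1, (0.1) p.251 (bookkeeping)] -/
theorem thi_tHi_succ_apply (L : ℕ) (hi : Fin d → ℤ) (n : ℕ) (i : Fin d) : thi L hi (n + 1) i = (L : ℤ) * thi L hi n i + ((L : ℤ) - 1) := by
  rw [B8Ineq130.thi_succ_apply]; ring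

end Windows

end Summit.QuantumFields.YangMills.BalabanUVNodes.N07CubeTowerUnderPrintWindow
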